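import Summits.NavierStokesRegularity.NavierStokesRegularity.Theses.HodographBetchov
import Literature.Analysis.FluidPDE.ConstantinDirectionDissipationProofs
import Literature.Analysis.FluidPDE.VorticityCalculus
import Literature.Analysis.FluidPDE.TaoEnstrophyLocalisationProofs
import Literature.Analysis.FluidPDE.TaoEnergyLocalisation
import Literature.Analysis.FluidPDE.SpaceTimeCalculusC1

/-!
# `SlowClassProduction` (stmt-NavierStokesRegularity-15831), line `near_field` — stub 1 `stub_curlBoundedProduction`

Route `HodographBetchov`, crux 2, planner skeleton `Cruxes/SlowClassProduction/Lines/near_field.lean`.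
**Vorticity-bounded regions carry an absolute production budget**: for a classical Navier–Stokes
solution on `ℝ³ × [0,T)` that is Leray–Hopf from a rapidly decaying datum and every `K` there is
`C` such that on EVERY set `E` of points of the open slab `(0,T) × ℝ³` at which `‖curl u‖ ≤ K`
the enstrophy production `P = ⟪ω, ∇u ω⟫` is integrable with `∫_E |P| ≤ C`.

Proof (a priori; the domination step of the landed `Birth.stub_deepSlowProduction` with the deep
piece replaced by the superset `A_K = {z ∈ (0,T) × ℝ³ : ‖ω(z)‖ ≤ K⁺}`).  Finite total dissipation
`D = ∫₀ᵀ∫ |∇u|²_F < ∞` (`IsLerayHopfOn.lintegral_frobeniusNormSq_fderiv_of_classical`); pointwise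
`|P| ≤ ‖∇u‖‖ω‖² ≤ κ K⁺ |∇u|²_F` on `A_K` (`κ = ‖curlCLM‖`, `norm_curl_le`,
`sq_opNorm_le_frobeniusNormSq`); the majorant is integrable on the slab (Tonelli); `A_K` is
measurable (relatively closed in the open slab by joint continuity of `ω`); domination gives
`P ∈ L¹(A_K)` and `∫_{A_K} |P| ≤ κ K⁺ D =: C`; an arbitrary `E ⊆ A_K` inherits integrability
(`IntegrableOn.mono_set`) and the bound (`setIntegral_mono_set`, `|P| ≥ 0`).
-/

noncomputable section

-- the summit and its single problem share the name `NavierStokesRegularity` (D-0017 nested layout)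
set_option linter.dupNamespace false

namespace Summit.NavierStokesRegularity.NavierStokesRegularity.Theorems.SlowClassProduction.NearField

open Set MeasureTheory Function Metric Filter Topology Literature.Analysis.FluidPDE
open scoped ENNReal NNReal ContDiff RealInnerProductSpace

/-- A sublevel set `{f ≤ K}` of a function continuous on an OPEN set `O`, cut to `O`, is measurable
(it is `O` minus the open set `O ∩ {K < f}`). [folklore] -/
theorem measurableSet_inter_preimage_Iic_of_continuousOn {O : Set (ℝ × EuclideanSpace ℝ (Fin 3))}
    (hO : IsOpen O) {f : ℝ × EuclideanSpace ℝ (Fin 3) → ℝ} (hf : ContinuousOn f O) (K : ℝ) :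
    MeasurableSet (O ∩ f ⁻¹' Set.Iic K) := by
  have hopen : IsOpen (O ∩ f ⁻¹' Ioi K) := hf.isOpen_inter_preimage hO isOpen_Ioi
  have heq : O ∩ f ⁻¹' Iic K = O \ (O ∩ f ⁻¹' Ioi K) := by
    ext z
    simp only [mem_inter_iff, mem_preimage, mem_Iic, Set.mem_sdiff, mem_Ioi, not_and, not_lt]
    tauto
  rw [heq]
  exact hO.measurableSet.diff hopen.measurableSet

/-- **Stub `stub_curlBoundedProduction` of line `near_field` for the crux `SlowClassProduction`
(stmt-NavierStokesRegularity-15831): vorticity-bounded regions carry an absolute production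
budget.**  For `ν, T > 0`, a classical solution `(u, p)` of the unforced Navier–Stokes system on
`ℝ³ × [0,T)` which is Leray–Hopf on `[0,T]` from its rapidly decaying datum, and every `K`, there is
`C` such that for every set `E` of points `(s,x)` with `0 < s < T` and `‖curl u(s,x)‖ ≤ K` the
production `⟪curl u, ∇u (curl u)⟫` is integrable on `E` with `∫_E |P| ≤ C`.  Proof: finite total
dissipation `D`, the domination `|P| ≤ ‖curlCLM‖ K⁺ |∇u|²_F` on the measurable superset
`A_K = {(s,x) ∈ (0,T) × ℝ³ : ‖ω‖ ≤ K⁺}`, Tonelli for the majorant, and monotonicity in the set;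
`C = ‖curlCLM‖ K⁺ D`. [cite: Leray1934, (5.2)] [cite: Constantin1990, §2] -/
theorem stub_curlBoundedProduction :
    ∀ (ν T : ℝ), 0 < ν → 0 < T →
      ∀ (u : ℝ → EuclideanSpace ℝ (Fin 3) → EuclideanSpace ℝ (Fin 3))
        (p : ℝ → EuclideanSpace ℝ (Fin 3) → ℝ),
        Literature.Analysis.FluidPDE.IsClassicalNSSolutionOn (Set.Ico 0 T) ν 0 u p →
        Literature.Analysis.FluidPDE.IsLerayHopfOn T ν 0 (u 0) u →
        Literature.Analysis.FluidPDE.HasRapidSpatialDecay (u 0) →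
        ∀ K : ℝ, ∃ C : ℝ, ∀ E : Set (ℝ × EuclideanSpace ℝ (Fin 3)),
          (∀ z ∈ E, z.1 ∈ Set.Ioo 0 T ∧ ‖Literature.Analysis.FluidPDE.curl (u z.1) z.2‖ ≤ K) →
            MeasureTheory.IntegrableOn
              (fun z : ℝ × EuclideanSpace ℝ (Fin 3) =>
                inner ℝ (Literature.Analysis.FluidPDE.curl (u z.1) z.2)
                  (fderiv ℝ (u z.1) z.2 (Literature.Analysis.FluidPDE.curl (u z.1) z.2))) E ∧
            ∫ z in E, |inner ℝ (Literature.Analysis.FluidPDE.curl (u z.1) z.2)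
                (fderiv ℝ (u z.1) z.2 (Literature.Analysis.FluidPDE.curl (u z.1) z.2))| ≤ C := by
  intro ν T hν hT u p hcl hLH _hdec K
  -- ### total dissipation
  set D : ℝ≥0∞ := ∫⁻ s in Ioo 0 T, ∫⁻ x, ENNReal.ofReal (frobeniusNormSq (fderiv ℝ (u s) x))
    with hD_def
  have hDfin : D ≠ ⊤ := (IsLerayHopfOn.lintegral_frobeniusNormSq_fderiv_of_classical hcl hLH hT).1
  set K' : ℝ := max K 0 with hK'_def
  have hK'0 : 0 ≤ K' := le_max_right _ _
  set κ : ℝ := ‖curlCLM‖ with hκ_def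
  have hκ0 : 0 ≤ κ := by rw [hκ_def]; exact norm_nonneg curlCLM
  -- ### notation
  set Df : ℝ × EuclideanSpace ℝ (Fin 3) → EuclideanSpace ℝ (Fin 3) →L[ℝ] EuclideanSpace ℝ (Fin 3) :=
    fun z => fderiv ℝ (u z.1) z.2 with hDf_def
  set P : ℝ × EuclideanSpace ℝ (Fin 3) → ℝ :=
    fun z => inner ℝ (curl (u z.1) z.2) (fderiv ℝ (u z.1) z.2 (curl (u z.1) z.2)) with hP_def
  set g : ℝ × EuclideanSpace ℝ (Fin 3) → ℝ := fun z => κ * K' * frobeniusNormSq (Df z) with hg_def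
  have hg0 : ∀ z, 0 ≤ g z := fun z => by
    rw [hg_def]
    exact mul_nonneg (mul_nonneg hκ0 hK'0) (frobeniusNormSq_nonneg _)
  -- ### pointwise domination at points with bounded vorticity
  have hP_le : ∀ z : ℝ × EuclideanSpace ℝ (Fin 3), ‖curl (u z.1) z.2‖ ≤ K' → ‖P z‖ ≤ g z := by
    intro z hω
    have hω0 : 0 ≤ ‖curl (u z.1) z.2‖ := norm_nonneg _
    have hωκ : ‖curl (u z.1) z.2‖ ≤ κ * ‖Df z‖ := norm_curl_le _ _
    calc ‖P z‖ ≤ ‖curl (u z.1) z.2‖ * ‖Df z (curl (u z.1) z.2)‖ := norm_inner_le_norm _ _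
      _ ≤ ‖curl (u z.1) z.2‖ * (‖Df z‖ * ‖curl (u z.1) z.2‖) := by
          gcongr
          exact (Df z).le_opNorm _
      _ = ‖curl (u z.1) z.2‖ * ‖curl (u z.1) z.2‖ * ‖Df z‖ := by ring
      _ ≤ K' * (κ * ‖Df z‖) * ‖Df z‖ := by gcongr
      _ = κ * K' * ‖Df z‖ ^ 2 := by ring
      _ ≤ κ * K' * frobeniusNormSq (Df z) := by
          gcongr
          exact sq_opNorm_le_frobeniusNormSq _
      _ = g z := by rw [hg_def]
  -- ### continuity on the open slab `(0,T) × ℝ³`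
  have hclo : IsClassicalNSSolutionOn (Ioo 0 T) ν 0 u p :=
    hcl.mono Ioo_subset_Ico_self isOpen_Ioo.uniqueDiffOn
  have hDcont : ContinuousOn Df (Ioo 0 T ×ˢ univ) :=
    continuousOn_fderiv_slice_of_contDiffOn (hclo.smooth_velocity.of_le (by norm_cast))
      isOpen_Ioo.uniqueDiffOn
  have hωcont : ContinuousOn (fun z : ℝ × EuclideanSpace ℝ (Fin 3) => curl (u z.1) z.2)
      (Ioo 0 T ×ˢ univ) :=
    curlCLM.continuous.comp_continuousOn hDcont
  have hPcont : ContinuousOn P (Ioo 0 T ×ˢ univ) := hωcont.inner (hDcont.clm_apply hωcont)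
  have hgcont : ContinuousOn g (Ioo 0 T ×ˢ univ) :=
    continuousOn_const.mul (continuous_frobeniusNormSq_clm.comp_continuousOn hDcont)
  have hopenS : IsOpen (Ioo (0 : ℝ) T ×ˢ (univ : Set (EuclideanSpace ℝ (Fin 3)))) :=
    isOpen_Ioo.prod isOpen_univ
  have hmeasS : MeasurableSet (Ioo (0 : ℝ) T ×ˢ (univ : Set (EuclideanSpace ℝ (Fin 3)))) :=
    measurableSet_Ioo.prod MeasurableSet.univ
  -- ### the majorant is integrable on the slab (Tonelli)
  have hg_int : IntegrableOn g (Ioo (0 : ℝ) T ×ˢ (univ : Set (EuclideanSpace ℝ (Fin 3)))) := by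
    refine ⟨hgcont.aestronglyMeasurable hmeasS, ?_⟩
    have hμ : (volume.restrict (Ioo (0 : ℝ) T ×ˢ (univ : Set (EuclideanSpace ℝ (Fin 3)))) :
        Measure (ℝ × EuclideanSpace ℝ (Fin 3))) =
        (volume.restrict (Ioo (0 : ℝ) T)).prod
          ((volume : Measure (EuclideanSpace ℝ (Fin 3))).restrict univ) := by
      rw [Measure.prod_restrict, ← Measure.volume_eq_prod]
    change ∫⁻ z, ‖g z‖ₑ ∂(volume.restrict (Ioo (0 : ℝ) T ×ˢ (univ : Set (EuclideanSpace ℝ (Fin 3))))) < ⊤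
    rw [hμ]
    calc ∫⁻ z, ‖g z‖ₑ ∂(volume.restrict (Ioo (0 : ℝ) T)).prod
            ((volume : Measure (EuclideanSpace ℝ (Fin 3))).restrict univ)
        ≤ ∫⁻ s in Ioo (0 : ℝ) T, ∫⁻ x in univ, ‖g (s, x)‖ₑ := lintegral_prod_le _
      _ = ∫⁻ s in Ioo (0 : ℝ) T, ∫⁻ x, ENNReal.ofReal (κ * K') *
            ENNReal.ofReal (frobeniusNormSq (fderiv ℝ (u s) x)) := by
          simp only [Measure.restrict_univ]
          refine lintegral_congr fun s => lintegral_congr fun x => ?_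
          rw [Real.enorm_eq_ofReal (hg0 (s, x)), hg_def]
          exact ENNReal.ofReal_mul (mul_nonneg hκ0 hK'0)
      _ = ENNReal.ofReal (κ * K') * D := by
          rw [hD_def, ← lintegral_const_mul' _ _ ENNReal.ofReal_ne_top]
          refine lintegral_congr fun s => ?_
          rw [lintegral_const_mul' _ _ ENNReal.ofReal_ne_top]
      _ < ⊤ := ENNReal.mul_lt_top ENNReal.ofReal_lt_top hDfin.lt_top
  -- ### the vorticity-bounded superset `A = {(s,x) ∈ (0,T) × ℝ³ : ‖ω‖ ≤ K⁺}`
  set A : Set (ℝ × EuclideanSpace ℝ (Fin 3)) :=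
    (Ioo (0 : ℝ) T ×ˢ (univ : Set (EuclideanSpace ℝ (Fin 3)))) ∩
      (fun z : ℝ × EuclideanSpace ℝ (Fin 3) => ‖curl (u z.1) z.2‖) ⁻¹' Iic K' with hA_def
  have hA : MeasurableSet A :=
    measurableSet_inter_preimage_Iic_of_continuousOn hopenS hωcont.norm K'
  have hAsub : A ⊆ Ioo (0 : ℝ) T ×ˢ (univ : Set (EuclideanSpace ℝ (Fin 3))) := inter_subset_left
  have hωA : ∀ z ∈ A, ‖curl (u z.1) z.2‖ ≤ K' := fun z hz => hz.2
  have hPA : IntegrableOn P A := by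
    refine Integrable.mono' (hg_int.mono_set hAsub) ((hPcont.mono hAsub).aestronglyMeasurable hA) ?_
    exact (ae_restrict_iff' hA).2 (ae_of_all _ fun z hz => hP_le z (hωA z hz))
  have hbudget : ∫ z in A, |P z| ≤
      ∫ z in Ioo (0 : ℝ) T ×ˢ (univ : Set (EuclideanSpace ℝ (Fin 3))), g z :=
    calc ∫ z in A, |P z| ≤ ∫ z in A, g z := by
          refine setIntegral_mono_on hPA.abs (hg_int.mono_set hAsub) hA fun z hz => ?_
          rw [← Real.norm_eq_abs]
          exact hP_le z (hωA z hz)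
      _ ≤ ∫ z in Ioo (0 : ℝ) T ×ˢ (univ : Set (EuclideanSpace ℝ (Fin 3))), g z :=
          setIntegral_mono_set hg_int (ae_of_all _ hg0) hAsub.eventuallyLE
  -- ### the budget on an arbitrary subset `E ⊆ A`
  refine ⟨∫ z in Ioo (0 : ℝ) T ×ˢ (univ : Set (EuclideanSpace ℝ (Fin 3))), g z, fun E hE => ?_⟩
  change IntegrableOn P E ∧ ∫ z in E, |P z| ≤ _
  have hEA : E ⊆ A := fun z hz =>
    ⟨mk_mem_prod (hE z hz).1 (mem_univ _), ((hE z hz).2.trans (le_max_left _ _) : _ ≤ K')⟩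
  refine ⟨hPA.mono_set hEA, ?_⟩
  calc ∫ z in E, |P z| ≤ ∫ z in A, |P z| :=
        setIntegral_mono_set hPA.abs (ae_of_all _ fun z => abs_nonneg _) hEA.eventuallyLE
    _ ≤ _ := hbudget

end Summit.NavierStokesRegularity.NavierStokesRegularity.Theorems.SlowClassProduction.NearField

end
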